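import Literature.AlgebraicGeometry.Resolution.ResiduallyAlgebraicReduction
import Literature.AlgebraicGeometry.Resolution.DiscreteSeparableResidueLocalUniformization
import Literature.AlgebraicGeometry.Resolution.ZariskiPatchingProperModelsWeakLU
import HarnessLib

/-!
# The residual local core granted Theorem D: rank one, residually algebraic, not `Disc`

Summit-side packaging (solo/informed residency, session 3), combining

* the ground-field enlargement of `ResiduallyAlgebraicReduction.lean` (relative local
  uniformization over `k` at `O` follows from relative local uniformization over the finitely
  generated subfields `k₁ ⊆ O` over which the residue field of `O` is algebraic), and
* the case split at `Disc(k₁, O)` := `O` is a discrete valuation ring and every residue of `O`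
  is separable-algebraic over `k₁` (`HasSeparableResidue`, elementwise),

with the model-form `μ_p`-torsor criterion at rank one (`MuPTorsorLocalUniformizationRelative`:
Novacoski–Spivakovsky, Temkin in height one, Cossart–Piltant in dimension `≤ 3`, Cutkosky at
Abhyankar places) and weak-LU patching of proper models (`ZariskiPatchingProperModelsWeakLU`).

`HD(p)` — the core model-form steps at every rank-one `O ⊇ k` with `Disc(k, O)`, for all fields
`k` of characteristic `p` — is **Theorem D** of the residency's notes (a CLAIMED result with a
prose proof, not formalised); it enters every statement below as the explicit hypothesis `HD`.

Main statements (granted `Temkin2013HeightLeOne`, `CossartPiltant2019LU3`, `HD`):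

* `relLocalUniformization_of_finalCore_relCoreSteps` — core steps at the rank-one, residually
  algebraic, non-`Disc` valuation rings (over all fields of characteristic `p`) ⇒ relative local
  uniformization at every valuation ring over every field of characteristic `p`;
* `resolutionInChar_iff_twoModelPatching_and_finalCore` — `ResolutionInChar p ⟺ two-model
  patching ∧ that residual local core`; `⇒` uses neither `HD` nor Temkin nor Cossart–Piltant;
* `resolutionOfSingularities_iff_twoModelPatching_and_finalCore` — the same for the summit.

Over a residually algebraic `O`, `¬ Disc(k, O)` means: the value group is not `ℤ` (rank one,
rational rank `≥ 2` or non-discrete of rational rank one), or it is `ℤ` and some residue is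
inseparable over `k` — the valuations at which no published or claimed mechanism produces the
torsor step in dimension `≥ 4`.
-/

noncomputable section

namespace Summit.ResolutionOfSingularities.ResolutionOfSingularities.Theorems

open CategoryTheory AlgebraicGeometry
open Literature.AlgebraicGeometry Literature.AlgebraicGeometry.Resolution Polynomial

/-- **Residual core ⇒ relative local uniformization everywhere** (characteristic `p`, any ground
field), granted Temkin (height one), Cossart–Piltant (dim ≤ 3) and Theorem D (`HD`): it suffices
to produce the core model-form `μ_p`-torsor steps at the valuation rings which are of rank one,
residually algebraic over the ground field, and not discrete with separable-algebraic residues. -/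
theorem relLocalUniformization_of_finalCore_relCoreSteps {p : ℕ} [Fact p.Prime]
    (hT₁ : Temkin2013HeightLeOne.{0}) (hCP : CossartPiltant2019LU3.{0})
    (HD : ∀ (k K : Type) [Field k] [CharP k p] [Field K] [Algebra k K],
      (⊤ : IntermediateField k K).FG → ∀ O : ValuationSubring K, Nonempty O.valuation.RankOne →
        (∀ c : k, algebraMap k K c ∈ O) → IsDiscreteValuationRing O →
        (∀ t : K, t ∈ O → HasSeparableResidue k O t) → RelMuPTorsorCoreStepsAt p k O)
    (H : ∀ (k K : Type) [Field k] [CharP k p] [Field K] [Algebra k K],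
      (⊤ : IntermediateField k K).FG → ∀ O : ValuationSubring K, Nonempty O.valuation.RankOne →
        (∀ c : k, algebraMap k K c ∈ O) → IsResiduallyAlgebraic k O →
        ¬ (IsDiscreteValuationRing O ∧ ∀ t : K, t ∈ O → HasSeparableResidue k O t) →
        RelMuPTorsorCoreStepsAt p k O)
    (k K : Type) [Field k] [CharP k p] [Field K] [Algebra k K] (O : ValuationSubring K) :
    RelLocalUniformization k K O := by
  classical
  refine NovacoskiSpivakovsky2014_holds k (fun K _ _ O hr => ?_) K O
  intro R hRfg hRfr hRO
  have hk : ∀ c : k, algebraMap k K c ∈ O := algebraMap_mem_of_le O R hRO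
  have hfg : (⊤ : IntermediateField k K).FG := fg_top_of_model R hRfg hRfr
  refine relLocalUniformization_of_forall_isResiduallyAlgebraic hfg O hk (fun k₁ hk₁O hra => ?_)
    R hRfg hRfr hRO
  haveI : CharP k₁ p := charP_of_injective_algebraMap (algebraMap k k₁).injective p
  have hfg₁ : (⊤ : IntermediateField k₁ K).FG := intermediateField_fg_top_of_fg_top k₁ hfg
  have hk₁ : ∀ c : k₁, algebraMap k₁ K c ∈ O := hk₁O
  by_cases hD : IsDiscreteValuationRing O ∧ ∀ t : K, t ∈ O → HasSeparableResidue k₁ O t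
  · exact relLocalUniformization_of_relCoreStepsAt_of_rankOne hT₁ hCP O hr hk₁
      (HD k₁ K hfg₁ O hr hk₁ hD.1 hD.2)
  · exact relLocalUniformization_of_relCoreStepsAt_of_rankOne hT₁ hCP O hr hk₁
      (H k₁ K hfg₁ O hr hk₁ hra hD)

/-- **Exact local proxy, residual form.** Granted Temkin (height one), Cossart–Piltant (dim ≤ 3)
and Theorem D (`HD`): relative local uniformization in characteristic `p` (all ground fields,
all valuation rings) is EQUIVALENT to the core model-form steps at the rank-one, residually
algebraic, non-`Disc` valuation rings; `⇒` is unconditional. -/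
theorem relLocalUniformization_iff_finalCore_relCoreSteps {p : ℕ} [Fact p.Prime]
    (hT₁ : Temkin2013HeightLeOne.{0}) (hCP : CossartPiltant2019LU3.{0})
    (HD : ∀ (k K : Type) [Field k] [CharP k p] [Field K] [Algebra k K],
      (⊤ : IntermediateField k K).FG → ∀ O : ValuationSubring K, Nonempty O.valuation.RankOne →
        (∀ c : k, algebraMap k K c ∈ O) → IsDiscreteValuationRing O →
        (∀ t : K, t ∈ O → HasSeparableResidue k O t) → RelMuPTorsorCoreStepsAt p k O) :
    (∀ (k K : Type) [Field k] [CharP k p] [Field K] [Algebra k K] (O : ValuationSubring K),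
        (∀ c : k, algebraMap k K c ∈ O) → RelLocalUniformization k K O) ↔
      ∀ (k K : Type) [Field k] [CharP k p] [Field K] [Algebra k K],
        (⊤ : IntermediateField k K).FG → ∀ O : ValuationSubring K,
          Nonempty O.valuation.RankOne → (∀ c : k, algebraMap k K c ∈ O) →
          IsResiduallyAlgebraic k O →
          ¬ (IsDiscreteValuationRing O ∧ ∀ t : K, t ∈ O → HasSeparableResidue k O t) →
            RelMuPTorsorCoreStepsAt p k O := by
  constructor
  · intro h k K _ _ _ _ _ O _ hk _ _
    refine relCoreStepsAt_of_relLocalUniformization O hk fun K' => h k K' _ fun c => ?_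
    rw [ValuationSubring.mem_comap, ← IsScalarTower.algebraMap_apply]
    exact hk c
  · intro h k K _ _ _ _ O _
    exact relLocalUniformization_of_finalCore_relCoreSteps hT₁ hCP HD
      (fun k K _ _ _ _ hfg O hr hk hra hD => h k K hfg O hr hk hra hD) k K O

/-- **The split of the summit's `p`-component at the residual core.** Granted Temkin (height
one), Cossart–Piltant (dim ≤ 3) and Theorem D (`HD`): resolution in characteristic `p` is
EQUIVALENT to two-model patching of proper models ∧ the core model-form `μ_p`-torsor steps at the
rank-one, residually algebraic valuation rings (of finitely generated extensions of fields of
characteristic `p`) which are NOT discrete with separable-algebraic residues. `⇒` uses none of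
the three hypotheses. -/
theorem resolutionInChar_iff_twoModelPatching_and_finalCore {p : ℕ} [Fact p.Prime]
    (hT₁ : Temkin2013HeightLeOne.{0}) (hCP : CossartPiltant2019LU3.{0})
    (HD : ∀ (k K : Type) [Field k] [CharP k p] [Field K] [Algebra k K],
      (⊤ : IntermediateField k K).FG → ∀ O : ValuationSubring K, Nonempty O.valuation.RankOne →
        (∀ c : k, algebraMap k K c ∈ O) → IsDiscreteValuationRing O →
        (∀ t : K, t ∈ O → HasSeparableResidue k O t) → RelMuPTorsorCoreStepsAt p k O) :
    ResolutionInChar.{0} p ↔ ProperModel.TwoModelPatching.{0} p ∧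
      (∀ (k K : Type) [Field k] [CharP k p] [Field K] [Algebra k K],
        (⊤ : IntermediateField k K).FG → ∀ O : ValuationSubring K,
          Nonempty O.valuation.RankOne → (∀ c : k, algebraMap k K c ∈ O) →
          IsResiduallyAlgebraic k O →
          ¬ (IsDiscreteValuationRing O ∧ ∀ t : K, t ∈ O → HasSeparableResidue k O t) →
            RelMuPTorsorCoreStepsAt p k O) :=
  ⟨fun h => ⟨ProperModel.twoModelPatching_of_resolutionInChar h,
      fun k K _ _ _ _ _ O _ hk _ _ => relCoreStepsAt_of_relLocalUniformization O hk fun K' =>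
        h.relLocalUniformization k K' (O.comap (algebraMap K' K))⟩,
    fun h => resolutionInChar_of_properTwoModelPatching_of_lu h.1
      (fun k K _ _ _ _ hfg O hk => isLocallyUniformizable_of_relLocalUniformization hfg O hk
        (relLocalUniformization_of_finalCore_relCoreSteps hT₁ hCP HD h.2 k K O))⟩

/-- **The summit itself, split at the residual core.** Granted Temkin (height one),
Cossart–Piltant (dim ≤ 3) and Theorem D for every prime (`HD`): resolution of singularities in
positive characteristic (verbatim `Literature.AlgebraicGeometry.Resolution.ResolutionOfSingularities`)
is EQUIVALENT to: for every prime `p`, two-model patching of proper models in characteristic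
`p` AND the core model-form `μ_p`-torsor steps at the rank-one, residually algebraic valuation
rings of finitely generated extensions of fields of characteristic `p` that are not discrete
with separable-algebraic residues. -/
theorem resolutionOfSingularities_iff_twoModelPatching_and_finalCore
    (hT₁ : Temkin2013HeightLeOne.{0}) (hCP : CossartPiltant2019LU3.{0})
    (HD : ∀ p : ℕ, p.Prime → ∀ (k K : Type) [Field k] [CharP k p] [Field K] [Algebra k K],
      (⊤ : IntermediateField k K).FG → ∀ O : ValuationSubring K, Nonempty O.valuation.RankOne →
        (∀ c : k, algebraMap k K c ∈ O) → IsDiscreteValuationRing O →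
        (∀ t : K, t ∈ O → HasSeparableResidue k O t) → RelMuPTorsorCoreStepsAt p k O) :
    Literature.AlgebraicGeometry.Resolution.ResolutionOfSingularities ↔
      ∀ p : ℕ, p.Prime → ProperModel.TwoModelPatching.{0} p ∧
      (∀ (k K : Type) [Field k] [CharP k p] [Field K] [Algebra k K],
        (⊤ : IntermediateField k K).FG → ∀ O : ValuationSubring K,
          Nonempty O.valuation.RankOne → (∀ c : k, algebraMap k K c ∈ O) →
          IsResiduallyAlgebraic k O →
          ¬ (IsDiscreteValuationRing O ∧ ∀ t : K, t ∈ O → HasSeparableResidue k O t) →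
            RelMuPTorsorCoreStepsAt p k O) := by
  refine forall_congr' fun p => forall_congr' fun hp => ?_
  haveI : Fact p.Prime := ⟨hp⟩
  exact resolutionInChar_iff_twoModelPatching_and_finalCore hT₁ hCP (HD p hp)

end Summit.ResolutionOfSingularities.ResolutionOfSingularities.Theorems

end
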